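import Summits.QuantumAdvantage.AdviceFreeQNC0.AffBells26TwoTestLemma
import HarnessLib

/-!
# `AffBells26.TwoSurvivorCriterion` PROVED (planner qn-p1 g26, ROUND-25 §5.2; ask P-26 (d), the `M−` item)

Prover seat qn-prover-3 g14.  **`twoSurvivorCriterion : TwoSurvivorCriterion`**: if an admissible cube `(x, A)` (`|A| ≥ 2`) has exactly
two surviving rows `g ≠ h`, the fibre has `≥ 5` coins, one of the two rows has two non-zero coin entries, and the coin parts of
`β_g, β_h` are neither equal nor opposite, then `(β, c)` loses on some odd input — for every `c`.

Proof.  With two survivors the cube constraint Q2 (`cubeConstraint`), evaluated at every point `flipAt y P` of the fibre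
(`P` an even set of coins; `kline_flipAt_coins` = `Fib19.kline_flipPair` for even coin sets; the cube data are fibre invariants,
`survSum_fibre`), says that the two tests `[form β · g = c_g + D_g]` and `[form β · h = c_h + D_h]` AGREE on the fibre
(`tests_agree`).  If the `g`-test fires somewhere on the fibre, re-base there: the coin parts `u_g(k) = β_{g,k}(1+y_k)`,
`u_h(k)` then have matching zero patterns of pair sums and four-sums, and the two-test coincidence lemma
(`twoTest_eq_or_neg`, `AffBells26TwoTestLemma.lean`) gives `u_h = ±u_g`, i.e. `β_h = ±β_g` on the coins — excluded.  If it fires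
nowhere, `avoid_lemma` bounds both coin supports by `1` — excluded by the two-non-zero-entries hypothesis.

With this file EVERY typed `def … : Prop` of Sketch26 except the conjectures S26 (`CubeRefutableAll`, `CubeRefutableDense`) is a tree
theorem.  WHAT THIS IS NOT: instrument for the (NP₀) rung of crux stmt-QuantumAdvantage-22907 (route DWalkThree); separation NOT moved.
-/

namespace Summit.QuantumAdvantage.AdviceFreeQNC0

namespace AffBells26

open Finset Literature.Computability.QuantumComplexity Literature.Computability.QuantumComplexity.RingHLF
open AffBells23 AffBells24 Fib19

variable {N : ℕ}

/-! ### Even coin flips stay in the fibre -/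

/-- Flipping an even set of coins keeps the odd class and the kernel line (`Fib19.kline_flipPair` for any even set). -/
theorem kline_flipAt_coins (hN : 3 ≤ N) (x : Fin N → Bool) (hodd : IsOdd x) (P : Finset (Fin N))
    (hP : ∀ k ∈ P, kline x k = false) (heven : P.card % 2 = 0) :
    IsOdd (flipAt x P) ∧ kline (flipAt x P) = kline x := by
  have hodd' : IsOdd (flipAt x P) := (isOdd_flipAt_of_even x P heven).2 hodd
  refine ⟨hodd', (kline_eq_iff_inKernel hN _ hodd' (kline_ne_zero hN x hodd)).2 ?_⟩
  exact (inKernel_flipAt_iff x (kline x) P hP).2 (kline_inKernel hN x hodd)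

/-- `Surv` is a fibre invariant. -/
theorem surv_flipAt_coins (β : Fin N → Fin N → ZMod 3) {x : Fin N → Bool} {A : Finset (Fin N)} (hA : Admissible x A)
    {P : Finset (Fin N)} (hP : ∀ k ∈ P, kline x k = false) (hk : kline (flipAt x P) = kline x) :
    Surv β (flipAt x P) A = Surv β x A := by
  unfold Surv
  rw [hk]
  refine filter_congr fun g _ => ?_
  constructor
  · rintro ⟨h1, h2⟩
    exact ⟨h1, fun a ha => by rw [← d_flipAt_coins β hA hP g (mem_of_mem_erase ha)]; exact h2 a ha⟩
  · rintro ⟨h1, h2⟩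
    exact ⟨h1, fun a ha => by rw [d_flipAt_coins β hA hP g (mem_of_mem_erase ha)]; exact h2 a ha⟩

/-- `D` is a fibre invariant. -/
theorem D_flipAt_coins (β : Fin N → Fin N → ZMod 3) {x : Fin N → Bool} {A : Finset (Fin N)} (hA : Admissible x A)
    {P : Finset (Fin N)} (hP : ∀ k ∈ P, kline x k = false) (g : Fin N) : D β (flipAt x P) A g = D β x A g := by
  unfold D
  exact sum_congr rfl fun a ha => d_flipAt_coins β hA hP g (mem_of_mem_erase ha)

/-! ### Two survivors: the two tests agree on the fibre -/

/-- Parity bookkeeping: `(1 + [p]) + (1 + [q])` is even iff `p ↔ q`. -/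
theorem iff_of_even (p q : Prop) [Decidable p] [Decidable q]
    (h : ((1 + if p then 1 else 0) + (1 + if q then 1 else 0)) % 2 = 0) : (p ↔ q) := by
  by_cases hp : p <;> by_cases hq : q <;> simp_all

/-- **The two tests agree on the fibre**: for a perfect strategy with `Surv = {g, h}`, at every even coin flip `y_P` of the base point
`[form β y_P g = c_g + D_g] ⟺ [form β y_P h = c_h + D_h]`. -/
theorem tests_agree (hN : 5 ≤ N) (β : Fin N → Fin N → ZMod 3) (c : Fin N → ZMod 3) {y : Fin N → Bool} {A : Finset (Fin N)}
    {g h : Fin N} (hodd : IsOdd y) (hA : Admissible y A) (hcard : 2 ≤ A.card) (hgh : g ≠ h) (hS : Surv β y A = {g, h})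
    (hperf : ∀ x' : Fin N → Bool, IsOdd x' → RingHLF.Rel x' (affBell β c x')) {P : Finset (Fin N)}
    (hP : ∀ k ∈ P, kline y k = false) (heven : P.card % 2 = 0) :
    (form β (flipAt y P) g = c g + D β y A g ↔ form β (flipAt y P) h = c h + D β y A h) := by
  obtain ⟨hodd', hk⟩ := kline_flipAt_coins (by omega) y hodd P hP heven
  have hA' : Admissible (flipAt y P) A := by
    unfold Admissible at hA ⊢; rw [hk]; exact hA
  have hq := cubeConstraint N hN β c hperf (flipAt y P) A hodd' hA' hcard
  rw [survSum_fibre β c hA hP hk, hS, sum_pair hgh] at hq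
  exact iff_of_even _ _ hq

/-! ### Sums over two and four coins -/

/-- Sum over a four-element set. -/
theorem sum_four {M : Type*} [AddCommMonoid M] (f : Fin N → M) {k l m n : Fin N} (hkl : k ≠ l) (hkm : k ≠ m) (hkn : k ≠ n)
    (hlm : l ≠ m) (hln : l ≠ n) (hmn : m ≠ n) :
    (∑ e ∈ ({k, l, m, n} : Finset (Fin N)), f e) = f k + f l + f m + f n := by
  rw [sum_insert (by simp [hkl, hkm, hkn]), sum_insert (by simp [hlm, hln]), sum_pair hmn]
  simp only [add_assoc]

/-- A four-element set has four elements. -/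
theorem card_four {k l m n : Fin N} (hkl : k ≠ l) (hkm : k ≠ m) (hkn : k ≠ n) (hlm : l ≠ m) (hln : l ≠ n) (hmn : m ≠ n) :
    ({k, l, m, n} : Finset (Fin N)).card = 4 := by
  rw [card_insert_of_notMem (by simp [hkl, hkm, hkn]), card_insert_of_notMem (by simp [hlm, hln]), card_pair hmn]

/-- `ZMod 3`: cancelling a common unit. -/
theorem z3_cancel : ∀ b b' u : ZMod 3, u ≠ 0 → b' * u = b * u → b' = b := by decide

/-- `ZMod 3`: cancelling a common unit, opposite sign. -/
theorem z3_cancel_neg : ∀ b b' u : ZMod 3, u ≠ 0 → b' * u = -(b * u) → b' = -b := by decide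

/-! ### The criterion -/

/-- **`TwoSurvivorCriterion`** (ROUND-25 §5.2). -/
theorem twoSurvivorCriterion : TwoSurvivorCriterion := by
  classical
  intro N hN β c x A g h hodd hA hcard hgh hS hZ hsupp hne hneg
  by_contra hno
  push Not at hno
  have hperf : ∀ x' : Fin N → Bool, IsOdd x' → RingHLF.Rel x' (affBell β c x') := hno
  -- the coins
  set C := (univ : Finset (Fin N)).filter fun k => kline x k = false with hC
  have hCmem : ∀ k, k ∈ C ↔ kline x k = false := fun k => by rw [hC, mem_filter]; simp
  have hC5 : 5 ≤ C.card := by rw [hC]; unfold zeros at hZ; exact hZ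
  -- the sign units of a base point
  have hunit : ∀ (y : Fin N → Bool) (k : Fin N), (if y k then (2 : ZMod 3) else 1) ≠ 0 := by
    intro y k; cases y k <;> decide
  by_cases hfire : ∃ P : Finset (Fin N), P ⊆ C ∧ P.card % 2 = 0 ∧ form β (flipAt x P) g = c g + D β x A g
  · -- (I) re-base at a fibre point where the g-test fires
    obtain ⟨P₀, hP₀C, hP₀e, hfg⟩ := hfire
    have hP₀ : ∀ k ∈ P₀, kline x k = false := fun k hk => (hCmem k).1 (hP₀C hk)
    obtain ⟨hodd₀, hk₀⟩ := kline_flipAt_coins (by omega) x hodd P₀ hP₀ hP₀e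
    have hS₀ : Surv β (flipAt x P₀) A = {g, h} := by rw [surv_flipAt_coins β hA hP₀ hk₀, hS]
    have hDg : D β (flipAt x P₀) A g = D β x A g := D_flipAt_coins β hA hP₀ g
    have hDh : D β (flipAt x P₀) A h = D β x A h := D_flipAt_coins β hA hP₀ h
    generalize hy : flipAt x P₀ = y at hodd₀ hk₀ hS₀ hDg hDh hfg
    have hA₀ : Admissible y A := by unfold Admissible at hA ⊢; rw [hk₀]; exact hA
    have hfh : form β y h = c h + D β x A h := by
      have := tests_agree hN β c hodd₀ hA₀ hcard hgh hS₀ hperf (P := ∅) (fun k hk => absurd hk (notMem_empty k))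
        (by rw [card_empty])
      rw [flipAt_empty', hDg, hDh] at this
      exact this.1 hfg
    -- the coin parts at the base point y
    set γ : Fin N → ZMod 3 := fun k => β g k * (if y k then 2 else 1) with hγ
    set γ' : Fin N → ZMod 3 := fun k => β h k * (if y k then 2 else 1) with hγ'
    have hsum : ∀ Q : Finset (Fin N), Q ⊆ C → Q.card % 2 = 0 →
        ((∑ k ∈ Q, γ k) = 0 ↔ (∑ k ∈ Q, γ' k) = 0) := by
      intro Q hQC hQe
      have hQ : ∀ k ∈ Q, kline y k = false := fun k hk => by rw [hk₀]; exact (hCmem k).1 (hQC hk)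
      have hta := tests_agree hN β c hodd₀ hA₀ hcard hgh hS₀ hperf hQ hQe
      rw [form_flipAt, form_flipAt, hDg, hDh, hfg, hfh] at hta
      constructor
      · intro h0
        have := hta.1 (by rw [show (∑ i ∈ Q, β g i * (if y i then 2 else 1)) = ∑ k ∈ Q, γ k from rfl, h0, add_zero])
        exact add_left_cancel (a := c h + D β x A h) (by rw [add_zero]; exact this)
      · intro h0
        have := hta.2 (by rw [show (∑ i ∈ Q, β h i * (if y i then 2 else 1)) = ∑ k ∈ Q, γ' k from rfl, h0, add_zero])
        exact add_left_cancel (a := c g + D β x A g) (by rw [add_zero]; exact this)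
    have h2 : PairAgree C γ γ' := by
      intro k hk l hl hkl
      have := hsum {k, l} (by intro e he; rw [mem_insert, mem_singleton] at he; rcases he with rfl | rfl <;> assumption)
        (by rw [card_pair hkl])
      rwa [sum_pair hkl, sum_pair hkl] at this
    have h4 : QuadAgree C γ γ' := by
      intro k hk l hl m hm n hn hkl hkm hkn hlm hln hmn
      have := hsum {k, l, m, n} (by
        intro e he
        simp only [mem_insert, mem_singleton] at he
        rcases he with rfl | rfl | rfl | rfl <;> assumption) (by rw [card_four hkl hkm hkn hlm hln hmn])
      rwa [sum_four γ hkl hkm hkn hlm hln hmn, sum_four γ' hkl hkm hkn hlm hln hmn] at this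
    have hsupp' : ∃ i ∈ C, ∃ j ∈ C, i ≠ j ∧ ((γ i ≠ 0 ∧ γ j ≠ 0) ∨ (γ' i ≠ 0 ∧ γ' j ≠ 0)) := by
      obtain ⟨i, j, hij, hi, hj, hb⟩ := hsupp
      refine ⟨i, (hCmem i).2 hi, j, (hCmem j).2 hj, hij, ?_⟩
      rcases hb with ⟨h1, h2'⟩ | ⟨h1, h2'⟩
      · left; exact ⟨mul_ne_zero h1 (hunit y i), mul_ne_zero h2' (hunit y j)⟩
      · right; exact ⟨mul_ne_zero h1 (hunit y i), mul_ne_zero h2' (hunit y j)⟩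
    rcases twoTest_eq_or_neg C hC5 γ γ' h2 h4 hsupp' with heq | hop
    · apply hne
      intro i hi
      have := heq i ((hCmem i).2 hi)
      exact (z3_cancel (β g i) (β h i) _ (hunit y i) this).symm
    · apply hneg
      intro i hi
      have := hop i ((hCmem i).2 hi)
      have e := z3_cancel_neg (β g i) (β h i) _ (hunit y i) this
      rw [e, neg_neg]
  · -- (II) the g-test never fires on the fibre: both coin supports have at most one element
    push Not at hfire
    set γ : Fin N → ZMod 3 := fun k => β g k * (if x k then 2 else 1) with hγ
    set γ' : Fin N → ZMod 3 := fun k => β h k * (if x k then 2 else 1) with hγ'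
    set a : ZMod 3 := c g + D β x A g - form β x g with ha
    set a' : ZMod 3 := c h + D β x A h - form β x h with ha'
    have hfire' : ∀ P : Finset (Fin N), P ⊆ C → P.card % 2 = 0 → form β (flipAt x P) h ≠ c h + D β x A h := by
      intro P hPC hPe hh
      have hP : ∀ k ∈ P, kline x k = false := fun k hk => (hCmem k).1 (hPC hk)
      exact hfire P hPC hPe ((tests_agree hN β c hodd hA hcard hgh hS hperf hP hPe).2 hh)
    have ha0 : a ≠ 0 := by
      intro h0
      apply hfire ∅ (empty_subset _) (by rw [card_empty])
      rw [flipAt_empty']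
      have : c g + D β x A g = a + form β x g := by rw [ha]; ring
      rw [this, h0, zero_add]
    have ha0' : a' ≠ 0 := by
      intro h0
      apply hfire' ∅ (empty_subset _) (by rw [card_empty])
      rw [flipAt_empty']
      have : c h + D β x A h = a' + form β x h := by rw [ha']; ring
      rw [this, h0, zero_add]
    -- the avoidance hypotheses for γ (row g) and γ' (row h)
    have hav : ∀ (Q : Finset (Fin N)), Q ⊆ C → Q.card % 2 = 0 →
        (∑ k ∈ Q, γ k) ≠ a ∧ (∑ k ∈ Q, γ' k) ≠ a' := by
      intro Q hQC hQe
      constructor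
      · intro hq
        apply hfire Q hQC hQe
        rw [form_flipAt, show (∑ i ∈ Q, β g i * (if x i then 2 else 1)) = ∑ k ∈ Q, γ k from rfl, hq, ha]
        ring
      · intro hq
        apply hfire' Q hQC hQe
        rw [form_flipAt, show (∑ i ∈ Q, β h i * (if x i then 2 else 1)) = ∑ k ∈ Q, γ' k from rfl, hq, ha']
        ring
    have hpairQ : ∀ k ∈ C, ∀ l ∈ C, k ≠ l → ({k, l} : Finset (Fin N)) ⊆ C := by
      intro k hk l hl _ e he
      rw [mem_insert, mem_singleton] at he
      rcases he with rfl | rfl <;> assumption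
    have hquadQ : ∀ k ∈ C, ∀ l ∈ C, ∀ m ∈ C, ∀ n ∈ C, ({k, l, m, n} : Finset (Fin N)) ⊆ C := by
      intro k hk l hl m hm n hn e he
      simp only [mem_insert, mem_singleton] at he
      rcases he with rfl | rfl | rfl | rfl <;> assumption
    obtain ⟨i, j, hij, hi, hj, hb⟩ := hsupp
    rcases hb with ⟨h1, h2'⟩ | ⟨h1, h2'⟩
    · have hγi : γ i ≠ 0 := mul_ne_zero h1 (hunit x i)
      have hγj : γ j ≠ 0 := mul_ne_zero h2' (hunit x j)
      refine hγj (avoid_lemma C hC5 γ a ha0 (fun k hk l hl hkl => ?_) (fun k hk l hl m hm n hn hkl hkm hkn hlm hln hmn => ?_)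
        ((hCmem i).2 hi) ((hCmem j).2 hj) hij hγi)
      · have := (hav {k, l} (hpairQ k hk l hl hkl) (by rw [card_pair hkl])).1
        rwa [sum_pair hkl] at this
      · have := (hav {k, l, m, n} (hquadQ k hk l hl m hm n hn) (by rw [card_four hkl hkm hkn hlm hln hmn])).1
        rwa [sum_four γ hkl hkm hkn hlm hln hmn] at this
    · have hγi : γ' i ≠ 0 := mul_ne_zero h1 (hunit x i)
      have hγj : γ' j ≠ 0 := mul_ne_zero h2' (hunit x j)
      refine hγj (avoid_lemma C hC5 γ' a' ha0' (fun k hk l hl hkl => ?_) (fun k hk l hl m hm n hn hkl hkm hkn hlm hln hmn => ?_)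
        ((hCmem i).2 hi) ((hCmem j).2 hj) hij hγi)
      · have := (hav {k, l} (hpairQ k hk l hl hkl) (by rw [card_pair hkl])).2
        rwa [sum_pair hkl] at this
      · have := (hav {k, l, m, n} (hquadQ k hk l hl m hm n hn) (by rw [card_four hkl hkm hkn hlm hln hmn])).2
        rwa [sum_four γ' hkl hkm hkn hlm hln hmn] at this

end AffBells26

end Summit.QuantumAdvantage.AdviceFreeQNC0
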